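import Mathlib
import Literature.Analysis.FluidPDE.VorticityCalculus
import Literature.Analysis.FluidPDE.HelicityDensityTransport
import Summits.NavierStokesRegularity.NavierStokesRegularity.Theorems.ThreadingFluxLoopLawFirstLemmas
import Summits.NavierStokesRegularity.NavierStokesRegularity.Theorems.ThreadingFluxHorizonTowerDefs
import Summits.NavierStokesRegularity.NavierStokesRegularity.Theorems.ThreadingFluxHorizonTowerTailRung
import Literature.Analysis.FluidPDE.PineauVicolEnstrophyTime
import HarnessLib

/-!
# Crux `PoloidalLiouville` (stmt-NavierStokesRegularity-1222, W1), crux idea «precession-gap» (ns-idea-15):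
# THE JET TOWER IS VOID ON RELATIVE EQUILIBRIA — kinematic S-lemmas (A) `LaplacianNeverThreads`,
# (B) `SteadyLoopLawAutomatic`, (C) `RotatingWaveStaysUnthreaded` of `Cruxes/PoloidalLiouville/PrecessionSketch.lean`,
# PROVED (bodies VERBATIM)

Support file (`--supports stmt-NavierStokesRegularity-1222`, helper).  Experiment cell `ns-wall-extremal`, width hand
ns-wall-eng-4 g3.  The sketch has no Theorems-side twin for these two statements, so the theorems below carry the sketch
BODIES VERBATIM with `IsUnthreadedAbout x₀ V = ∀ x, threading x₀ V x = 0`, `threading x₀ V x = ⟪x − x₀, curl V x⟫` and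
`IsRotatingWave x₀ Ω V v = ∀ t x, v t x = rotZ (Ω * t) (V (rotZ (-(Ω * t)) (x - x₀)))` unfolded.

* `Precession.laplacianNeverThreads` (A, S — kinematic): for `V ∈ C³` unthreaded about `x₀`, `ΔV` is unthreaded about `x₀`:
  `⟪y, curl ΔV⟫ = ⟪y, Δ curl V⟫ = Δ⟪y, curl V⟫ − 2 div curl V = 0` (`curl Δ = Δ curl`, the Leibniz rule
  `LoopLaw.laplacian_inner_sub_const_eq`, `div curl = 0`).
* `Precession.steadyLoopLawAutomatic` (B, S): for a classical steady Navier–Stokes state `(V·∇)V + ∇p = ΔV` unthreaded about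
  `x₀`, the advection term `(V·∇)V` is unthreaded about `x₀` (`curl ∇p = 0` and (A)); so every threading coefficient vanishes
  on steady states — the jet tower carries no information on this stratum.
* `Precession.rotatingWaveStaysUnthreaded` (C, S): a rotating wave `v(t, x₀ + y) = R_{Ωt} V(R_{−Ωt} y)` whose profile `V ∈ C¹` is
  unthreaded about the origin is unthreaded about `x₀` at all times (equivariance of `curl` under rotations, Literature
  `PineauVicol2026.curl_rotZ_conj`, and `‖R y‖`-invariance of the inner product).

HONEST FRAME: kinematics; the card's rungs (`ShortPeriodCollapse`, `FastPrecession…`) are not touched; `PoloidalLiouville`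
(1222) and NS regularity stay OPEN; W1/W2 movement 0.

## References
* planner ns-idea-15, `Cruxes/PoloidalLiouville/Ideas/precession-gap.md`, `…/PrecessionSketch.lean` ((A), (B)).
* A. J. Majda, A. L. Bertozzi, *Vorticity and Incompressible Flow* (CUP 2002), §1.1, §2.1. [MajdaBertozziCUP2002]
-/

-- the summit and its single problem share the name (D-0017 nested layout)
set_option linter.dupNamespace false

noncomputable section

namespace Summit.NavierStokesRegularity.NavierStokesRegularity.Theorems.PoloidalLiouville.Precession

open Set Function Filter Topology
open scoped Topology RealInnerProductSpace Laplacian ContDiff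
open Literature.Analysis.FluidPDE
open Summit.NavierStokesRegularity.NavierStokesRegularity.Theorems.PoloidalLiouville.HorizonTower (E3)

/-- **(A) THE LAPLACIAN NEVER THREADS** (body of the sketch's `LaplacianNeverThreads`, VERBATIM with `IsUnthreadedAbout`
unfolded): if `V ∈ C³` is unthreaded about `x₀` (`⟪x − x₀, curl V x⟫ = 0` for all `x`), so is `ΔV`.
[cite: MajdaBertozziCUP2002, §1.1 (vector identities)] -/
theorem laplacianNeverThreads :
    ∀ (V : E3 → E3) (x₀ : E3), ContDiff ℝ 3 V → (∀ x, inner ℝ (x - x₀) (curl V x) = 0) →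
    ∀ x, inner ℝ (x - x₀) (curl (Laplacian.laplacian V) x) = 0 := by
  intro V x₀ hV hun x
  have hV2 : ContDiff ℝ 2 V := hV.of_le (by norm_cast)
  have hω2 : ContDiff ℝ 2 (curl V) := contDiff_curl (n := 2) (by exact_mod_cast hV)
  have hdiv : VectorCalculus.divergence (curl V) x = 0 :=
    HelicityDensityTransport.divergence_curl_eq_zero_of_contDiffAt hV2.contDiffAt
  have hzero : (fun y : E3 => inner ℝ (y - x₀) (curl V y)) = fun _ => (0 : ℝ) := funext hun
  have h := LoopLaw.laplacian_inner_sub_const_eq hω2 x₀ x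
  rw [hzero, laplacian_const_eq_zero, hdiv, mul_zero, add_zero] at h
  rw [curl_laplacian hV x]
  exact h.symm

/-- **(B) STEADY STATES PASS EVERY JET SIEVE FOR FREE** (body of the sketch's `SteadyLoopLawAutomatic`, VERBATIM with
`IsUnthreadedAbout` unfolded): for a classical steady Navier–Stokes state `(V·∇)V + ∇p = ΔV` (`V ∈ C³`, `p ∈ C²`)
unthreaded about `x₀`, the advection term `(V·∇)V` is unthreaded about `x₀`.  (Divergence-freeness is not used.)
[cite: MajdaBertozziCUP2002, §1.1 (vector identities)] -/
theorem steadyLoopLawAutomatic :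
    ∀ (V : E3 → E3) (p : E3 → ℝ) (x₀ : E3), ContDiff ℝ 3 V → ContDiff ℝ 2 p → VectorCalculus.IsDivFree V →
    (∀ x, fderiv ℝ V x (V x) + gradient p x = Laplacian.laplacian V x) →
    (∀ x, inner ℝ (x - x₀) (curl V x) = 0) →
    ∀ x, inner ℝ (x - x₀) (curl (fun x => fderiv ℝ V x (V x)) x) = 0 := by
  intro V p x₀ hV hp _hdiv hsteady hun x
  -- `(V·∇)V = ΔV − ∇p`
  have heq : (fun y : E3 => fderiv ℝ V y (V y)) = fun y => (Δ V) y - gradient p y :=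
    funext fun y => eq_sub_of_add_eq (hsteady y)
  have hΔ : ContDiff ℝ 1 (fun y : E3 => (Δ V) y) := by
    -- regularity of `ΔV` through `Δ = Σ ∂ᵢ∂ᵢ`
    set b := stdOrthonormalBasis ℝ (EuclideanSpace ℝ (Fin 3))
    have hd1 : ∀ e, ContDiff ℝ 2 fun y : E3 => fderiv ℝ V y e := fun e =>
      (hV.fderiv_right (m := 2) (by norm_cast)).clm_apply contDiff_const
    have hd2 : ∀ e e', ContDiff ℝ 1 fun y : E3 => fderiv ℝ (fun z => fderiv ℝ V z e) y e' := fun e e' =>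
      ((hd1 e).fderiv_right (m := 1) (by norm_cast)).clm_apply contDiff_const
    have hΔeq : (fun y : E3 => (Δ V) y) = fun y => ∑ i, fderiv ℝ (fun z => fderiv ℝ V z (b i)) y (b i) :=
      funext fun y => laplacian_eq_sum_fderiv_fderiv b (hV.of_le (by norm_cast)) y
    rw [hΔeq]
    exact ContDiff.sum fun i _ => hd2 (b i) (b i)
  have hgrad : ContDiff ℝ 1 (gradient p) :=
    (InnerProductSpace.toDual ℝ (EuclideanSpace ℝ (Fin 3))).symm.contDiff.comp (hp.fderiv_right (m := 1) le_rfl)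
  rw [heq, curl_sub ((hΔ.differentiable (by norm_num)) x) ((hgrad.differentiable (by norm_num)) x),
    inner_sub_right, curl_gradient_eq_zero_holds p hp x, inner_zero_right, sub_zero]
  exact laplacianNeverThreads V x₀ hV hun x

/-- **(C) PRECESSING STATES PASS EVERY JET SIEVE FOR FREE** (body of the sketch's `RotatingWaveStaysUnthreaded`, VERBATIM
with `IsRotatingWave` and `IsUnthreadedAbout` unfolded): by the equivariance of `curl` under the rotations `rotZ`, a rotating
wave about the axis through `x₀` whose profile is unthreaded about the centre is unthreaded about `x₀` at all times.
[cite: MajdaBertozziCUP2002, §1.1 (vector identities)] -/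
theorem rotatingWaveStaysUnthreaded :
    ∀ (v : ℝ → E3 → E3) (x₀ : E3) (Ω : ℝ) (V : E3 → E3), ContDiff ℝ 1 V →
    (∀ t x, v t x = rotZ (Ω * t) (V (rotZ (-(Ω * t)) (x - x₀)))) →
    (∀ x, inner ℝ (x - 0) (curl V x) = 0) →
    ∀ t, ∀ x, inner ℝ (x - x₀) (curl (v t) x) = 0 := by
  intro v x₀ Ω V hV hwave hun t x
  have hVd : Differentiable ℝ V := hV.differentiable (by norm_num)
  have hvt : v t = fun z => (fun w => rotZ (Ω * t) (V (rotZ (-(Ω * t)) w))) (z - x₀) := funext fun z => hwave t z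
  rw [hvt, HorizonTower.curl_comp_sub (fun w => rotZ (Ω * t) (V (rotZ (-(Ω * t)) w))) x₀ x,
    PineauVicol2026.curl_rotZ_conj hVd]
  have hy : x - x₀ = rotZ (Ω * t) (rotZ (-(Ω * t)) (x - x₀)) := by
    rw [← rotZ_add, add_neg_cancel, rotZ_zero]
  have hiso : ∀ a b : E3, inner ℝ (rotZ (Ω * t) a) (rotZ (Ω * t) b) = inner ℝ a b := fun a b =>
    (rotZLIE (Ω * t)).inner_map_map a b
  set c := curl V (rotZ (-(Ω * t)) (x - x₀)) with hc
  rw [hy, hiso]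
  have h := hun (rotZ (-(Ω * t)) (x - x₀))
  rwa [sub_zero] at h

end Summit.NavierStokesRegularity.NavierStokesRegularity.Theorems.PoloidalLiouville.Precession

end
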